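import Summits.ResolutionOfSingularities.ResolutionOfSingularities.Theorems.PurelyInseparableDim4Target
import Summits.ResolutionOfSingularities.ResolutionOfSingularities.Theorems.PurelyInseparableDim4Rules
import Literature.AlgebraicGeometry.Resolution.CentreBlowupMohStability
import Literature.AlgebraicGeometry.Resolution.CentreBlowupOrdAlongBasics
import HarnessLib

/-!
# [OURS · res-dim4-pi] S₄-EQUIVARIANCE OF THE MODEL: the coordinate-centre step and every step RELATION of
  the frame commute with renaming the variables (what a coordinate-rule's lex tie-break does NOT do)

Cell `res-dim4-pi` (D-0157 DOOR 2, wave 2), seat `res-dim4-p-6`; the kernel ground truth behind desk WORD #25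
(a) (EN-0 located: «engine B's S₄-memo × MODE 1h's non-equivariant lex tie-break») and the input of the
S₄-equivariance audit EN-10.  Typed over the TREE's `CentreBlowup.degIn / ordAlong / chartExponent /
chartTransform / pointTransform / newMult / newExc / step` (`PointBlowupShadeCentres`), `PointBlowup.translate`,
`Hauser2010.deletePthPowers`, and the landed frame `PurelyInseparableDim4Target` / `…Rules` (`State.rename`,
`IsPermissibleCentre`, `Perm2`, `IsMode1hCentre`, `Edge`, `Step0 / Step1h / Step2 / StepHP / StepRule`,
`IsEquivariantRule`, `IsTrap`).  Nothing is restated; no definition is introduced.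

## What is proved (every permutation `e` of the variables; §1–§2 for any finite `σ`, any field, any `q`)

* §1 exponents: `degIn_map` (`degIn (e S) (e d) = degIn S d`), `isPthPowerExponent_mapDomain_iff`,
  **`chartExponent_map`** (the chart law is equivariant).
* §2 polynomials: `coeff_rename_perm`, **`ordAlong_rename`** (`ord_{e S} (e F) = ord_S F`), `ordZero_rename`,
  **`chartTransform_rename`**, **`translate_rename`** (`translate (b ∘ e⁻¹) (e G) = e (translate b G)`),
  **`deletePthPowers_rename`** (cleaning is equivariant).
* §3 the cell's states (`σ = Fin 4`, `State.rename e s = (e F, r ∘ e⁻¹, e exc)`): `pointTransform_rename`,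
  `newMult_rename`, `newExc_rename`, and **`step_rename :
  step q (e S) (e j) (b ∘ e⁻¹) (s.rename e) = (step q S j b s).rename e`**; `rename_rename_symm` (renaming back).
* §4 the RELATIONS of record are equivariant (with ALL ties allowed, as typed): `isPermissibleCentre_rename_iff`,
  `shade_rename`, `perm2_rename_iff`, `isEquimultiplePoint_rename_iff`, `isMode1hCentre_rename_iff`,
  **`edge_rename`**, **`step0_rename / step1h_rename / step2_rename / stepHP_rename`** and their `_iff` forms,
  `riseD_rename_iff`; `stepRule_rename` for an `IsEquivariantRule`; **`isTrap_image`** (the S₄-image of a trap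
  is a trap).  Consequently every termination frame of the cell (`Terminates1h`, `TerminatesSomeRule`, …) is a
  statement about S₄-ORBITS of presented states: an engine may memoise states up to `S₄` for these relations —
  but NOT for a particular non-equivariant RULE (a lex tie-break among MODE-1h ties), which is exactly the located
  cause of the A-vs-B discrepancy of WORD #25 (a).

Scope (honest): permutations of the four base variables only; translations transform as `b ↦ b ∘ e⁻¹`.
[OURS · counted 0 · elementary · AI kernel work, weaker than expert review.]  NOTHING here is a statement about
resolution of singularities; resolution in dimension `≥ 4` / characteristic `p > 0` is NOT proved by anything in
this file.  bears_on: LADDER-RESOLUTION:D157-DOOR2 (res-dim4-pi).  Host item: `stmt-ResolutionOfSingularities-16155`.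
-/

noncomputable section

set_option linter.dupNamespace false -- mandated namespace of this single-conjunct summit

open MvPolynomial Finset

namespace Summit.ResolutionOfSingularities.ResolutionOfSingularities.Theorems.PIDim4

namespace Equivariance

open Literature.AlgebraicGeometry.Resolution
open Literature.AlgebraicGeometry.Resolution.CentreBlowup
open Literature.AlgebraicGeometry.Resolution.Hauser2010

section General

variable {σ : Type*} {K : Type*} [Field K] [Fintype σ] [DecidableEq σ] (e : Equiv.Perm σ)

/-! ## §1 Exponents -/

omit [Fintype σ] [DecidableEq σ] in
/-- A renamed exponent read at a renamed index. [folklore] -/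
theorem mapDomain_apply_perm (d : σ →₀ ℕ) (i : σ) : d.mapDomain e (e i) = d i := by
  rw [Finsupp.mapDomain_equiv_apply, Equiv.symm_apply_apply]

omit [Fintype σ] [DecidableEq σ] in
/-- `degIn` is equivariant: `degIn (e S) (e d) = degIn S d`. [folklore] -/
theorem degIn_map (S : Finset σ) (d : σ →₀ ℕ) : degIn (S.map e.toEmbedding) (d.mapDomain e) = degIn S d := by
  unfold degIn
  rw [Finset.sum_map]
  exact Finset.sum_congr rfl fun i _ => by rw [Equiv.coe_toEmbedding, mapDomain_apply_perm]

omit [Fintype σ] [DecidableEq σ] in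
/-- `q`-th-power exponents are preserved by renaming. [folklore] -/
theorem isPthPowerExponent_mapDomain_iff (q : ℕ) (d : σ →₀ ℕ) :
    IsPthPowerExponent q (d.mapDomain e) ↔ IsPthPowerExponent q d := by
  rw [isPthPowerExponent_iff, isPthPowerExponent_iff]
  constructor
  · intro h i
    have := h (e i)
    rwa [mapDomain_apply_perm] at this
  · intro h i
    rw [Finsupp.mapDomain_equiv_apply]
    exact h _

omit [Fintype σ] in
/-- **The chart law is equivariant**: `chartExponent q (e S) (e j) (e d) = e (chartExponent q S j d)`.
[cite: HauserPerlega2019PRIMS, §2 (the blowup in the x₁-chart)] -/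
theorem chartExponent_map (q : ℕ) (S : Finset σ) (j : σ) (d : σ →₀ ℕ) :
    chartExponent q (S.map e.toEmbedding) (e j) (d.mapDomain e) = (chartExponent q S j d).mapDomain e := by
  ext i
  obtain ⟨i, rfl⟩ := e.surjective i
  rw [mapDomain_apply_perm]
  by_cases hij : i = j
  · subst hij
    rw [chartExponent_apply_self, chartExponent_apply_self, degIn_map]
  · rw [chartExponent_apply_of_ne _ _ (fun h => hij (e.injective h)), chartExponent_apply_of_ne _ _ hij,
      mapDomain_apply_perm]

/-! ## §2 Polynomials -/

omit [Fintype σ] [DecidableEq σ] in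
/-- Coefficients of a renamed polynomial: `coeff D (e P) = coeff (e⁻¹ D) P`. [folklore] -/
theorem coeff_rename_perm (P : MvPolynomial σ K) (D : σ →₀ ℕ) :
    coeff D (rename e P) = coeff (D.mapDomain e.symm) P := by
  have hD : D = (D.mapDomain e.symm).mapDomain e := by
    rw [← Finsupp.mapDomain_comp, Equiv.self_comp_symm, Finsupp.mapDomain_id]
  conv_lhs => rw [hD]
  exact coeff_rename_mapDomain e e.injective P _

omit [Fintype σ] [DecidableEq σ] in
/-- **`ordAlong` is equivariant**: `ord_{e S} (e F) = ord_S F`. [cite: HauserPerlega2019PRIMS, §2 (ord_P)] -/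
theorem ordAlong_rename (S : Finset σ) (F : MvPolynomial σ K) :
    ordAlong (S.map e.toEmbedding) (rename e F) = ordAlong S F := by
  apply le_antisymm
  · refine le_ordAlong_iff.mpr fun d hd => ?_
    have hmem : d.mapDomain e ∈ (rename e F).support := by
      rw [MvPolynomial.mem_support_iff, coeff_rename_mapDomain e e.injective]
      exact MvPolynomial.mem_support_iff.mp hd
    calc ordAlong (S.map e.toEmbedding) (rename e F) ≤ (degIn (S.map e.toEmbedding) (d.mapDomain e) : ℕ∞) :=
          ordAlong_le_of_mem_support hmem
      _ = (degIn S d : ℕ∞) := by rw [degIn_map]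
  · refine le_ordAlong_iff.mpr fun D hD => ?_
    obtain ⟨d, rfl, hd⟩ := coeff_rename_ne_zero e F D (MvPolynomial.mem_support_iff.mp hD)
    calc ordAlong S F ≤ (degIn S d : ℕ∞) := ordAlong_le_of_coeff_ne_zero hd
      _ = (degIn (S.map e.toEmbedding) (d.mapDomain e) : ℕ∞) := by rw [degIn_map]

omit [DecidableEq σ] in
/-- The order at the origin is invariant under renaming. [folklore] -/
theorem ordZero_rename (F : MvPolynomial σ K) : ordZero (rename e F) = ordZero F := by
  rw [← ordAlong_univ, ← ordAlong_univ, ← Finset.map_univ_equiv e, ordAlong_rename, Finset.map_univ_equiv]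

omit [Fintype σ] in
/-- **The chart transform is equivariant**: `chartTransform q (e S) (e j) (e F) = e (chartTransform q S j F)`.
[cite: HauserPerlega2019PRIMS, §2 (the blowup in the x₁-chart)] -/
theorem chartTransform_rename (q : ℕ) (S : Finset σ) (j : σ) (F : MvPolynomial σ K) :
    chartTransform q (S.map e.toEmbedding) (e j) (rename e F) = rename e (chartTransform q S j F) := by
  unfold chartTransform
  rw [support_rename_of_injective e.injective,
    Finset.sum_image fun x _ y _ h => Finsupp.mapDomain_injective e.injective h, map_sum]
  refine Finset.sum_congr rfl fun d _ => ?_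
  rw [rename_monomial, chartExponent_map, coeff_rename_mapDomain e e.injective]

omit [Fintype σ] [DecidableEq σ] in
/-- **Translations are equivariant**: `translate (b ∘ e⁻¹) (e G) = e (translate b G)` — the point `b` of the
old chart is the point `b ∘ e⁻¹` of the renamed chart. [folklore] -/
theorem translate_rename (b : σ → K) (G : MvPolynomial σ K) :
    PointBlowup.translate (b ∘ e.symm) (rename e G) = rename e (PointBlowup.translate b G) := by
  unfold PointBlowup.translate
  rw [aeval_rename, ← AlgHom.comp_apply]
  have h : aeval ((fun i => (X i + C ((b ∘ e.symm) i) : MvPolynomial σ K)) ∘ e) =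
      (rename e).comp (aeval fun i => (X i + C (b i) : MvPolynomial σ K)) :=
    MvPolynomial.algHom_ext fun i => by
      simp only [AlgHom.comp_apply, aeval_X, Function.comp_apply, map_add, rename_X, rename_C,
        Equiv.symm_apply_apply]
  exact DFunLike.congr_fun h G

omit [Fintype σ] in
/-- **Cleaning is equivariant**: deleting the `q`-th-power monomials commutes with renaming.
[cite: Hauser2010, §G (cleaning)] -/
theorem deletePthPowers_rename (q : ℕ) (P : MvPolynomial σ K) :
    deletePthPowers q (rename e P) = rename e (deletePthPowers q P) := by
  ext D
  rw [coeff_deletePthPowers, coeff_rename_perm, coeff_rename_perm, coeff_deletePthPowers]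
  by_cases h : IsPthPowerExponent q D
  · rw [if_pos h, if_pos ((isPthPowerExponent_mapDomain_iff e.symm q D).mpr h)]
  · rw [if_neg h, if_neg fun h' => h ((isPthPowerExponent_mapDomain_iff e.symm q D).mp h')]

end General

/-! ## §3 The cell's presented states: the step is equivariant -/

section Cell

variable {K : Type} [Field K] [DecidableEq K] (e : Equiv.Perm (Fin 4))

omit [DecidableEq K] in
/-- The residual polynomial of a renamed state. [folklore] -/
theorem rename_F (s : State K) : (s.rename e).F = rename e s.F := rfl

omit [DecidableEq K] in
/-- The multiplicities of a renamed state. [folklore] -/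
theorem rename_r (s : State K) : (s.rename e).r = s.r.mapDomain e := rfl

omit [DecidableEq K] in
/-- The exceptional components of a renamed state. [folklore] -/
theorem rename_exc (s : State K) : (s.rename e).exc = s.exc.map e.toEmbedding := rfl

omit [DecidableEq K] in
/-- `(e⁻¹ S)` renamed by `e` is `S`. [folklore] -/
theorem map_symm_map (S : Finset (Fin 4)) : (S.map e.symm.toEmbedding).map e.toEmbedding = S := by
  ext x
  rw [Finset.mem_map_equiv, Finset.mem_map_equiv, Equiv.symm_symm, Equiv.apply_symm_apply]

omit [DecidableEq K] in
/-- Renaming back: `(s.rename e).rename e⁻¹ = s`. [folklore] -/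
theorem rename_rename_symm (s : State K) : (s.rename e).rename e.symm = s := by
  obtain ⟨F, r, exc⟩ := s
  show (⟨rename e.symm (rename e F), (r.mapDomain e).mapDomain e.symm,
      (exc.map e.toEmbedding).map e.symm.toEmbedding⟩ : State K) = ⟨F, r, exc⟩
  congr 1
  · rw [rename_rename, Equiv.symm_comp_self]
    exact DFunLike.congr_fun rename_id F
  · rw [← Finsupp.mapDomain_comp, Equiv.symm_comp_self, Finsupp.mapDomain_id]
  · have := map_symm_map e.symm exc
    rwa [Equiv.symm_symm] at this

omit [DecidableEq K] in
/-- The transform seen at the renamed chart point is the renamed transform. [folklore] -/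
theorem pointTransform_rename (q : ℕ) (S : Finset (Fin 4)) (j : Fin 4) (b : Fin 4 → K) (s : State K) :
    pointTransform q (S.map e.toEmbedding) (e j) (b ∘ e.symm) (s.rename e) =
      rename e (pointTransform q S j b s) := by
  unfold pointTransform
  rw [rename_F, chartTransform_rename, translate_rename]

/-- The new multiplicities are equivariant. [cite: Hauser2010, §F (transform D' of the exceptional divisor)] -/
theorem newMult_rename (q : ℕ) (S : Finset (Fin 4)) (j : Fin 4) (b : Fin 4 → K) (s : State K) :
    newMult q (S.map e.toEmbedding) (e j) (b ∘ e.symm) (s.rename e) = (newMult q S j b s).mapDomain e := by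
  ext i
  obtain ⟨i, rfl⟩ := e.surjective i
  unfold newMult
  rw [mapDomain_apply_perm, Finsupp.update_apply, Finsupp.update_apply, rename_F, ordAlong_rename]
  by_cases hij : i = j
  · subst hij
    rw [if_pos rfl, if_pos rfl]
  · rw [if_neg (fun h => hij (e.injective h)), if_neg hij, Finsupp.filter_apply, Finsupp.filter_apply,
      rename_r, mapDomain_apply_perm, Function.comp_apply, Equiv.symm_apply_apply]

/-- The new set of exceptional components is equivariant. [cite: Hauser2010, §F (transform D')] -/
theorem newExc_rename (j : Fin 4) (b : Fin 4 → K) (s : State K) :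
    newExc (e j) (b ∘ e.symm) (s.rename e) = (newExc j b s).map e.toEmbedding := by
  ext i
  obtain ⟨i, rfl⟩ := e.surjective i
  simp only [newExc, rename_exc, Finset.mem_insert, Finset.mem_filter, Finset.mem_map_equiv,
    e.injective.eq_iff, Function.comp_apply, Equiv.symm_apply_apply]

/-- **THE STEP IS EQUIVARIANT**: renaming the variables, the centre, the chart and the point of a
coordinate-centre step renames its result — `step q (e S) (e j) (b ∘ e⁻¹) (s.rename e) = (step q S j b s).rename e`.
[cite: Hauser2010, §§F–G (blowup followed by cleaning)] [cite: HauserPerlega2019PRIMS, §2] -/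
theorem step_rename (q : ℕ) (S : Finset (Fin 4)) (j : Fin 4) (b : Fin 4 → K) (s : State K) :
    CentreBlowup.step q (S.map e.toEmbedding) (e j) (b ∘ e.symm) (s.rename e) =
      State.rename e (CentreBlowup.step q S j b s) := by
  show (⟨deletePthPowers q (pointTransform q (S.map e.toEmbedding) (e j) (b ∘ e.symm) (s.rename e)),
      newMult q (S.map e.toEmbedding) (e j) (b ∘ e.symm) (s.rename e),
      newExc (e j) (b ∘ e.symm) (s.rename e)⟩ : State K) =
    ⟨rename e (deletePthPowers q (pointTransform q S j b s)), (newMult q S j b s).mapDomain e,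
      (newExc j b s).map e.toEmbedding⟩
  rw [pointTransform_rename, deletePthPowers_rename, newMult_rename, newExc_rename]

/-! ## §4 The relations of record are equivariant -/

omit [DecidableEq K] in
/-- Hironaka-permissibility (condition (1)) is equivariant. [cite: HauserPerlega2019PRIMS, §2 (condition (1))] -/
theorem isPermissibleCentre_rename_iff (q : ℕ) (S : Finset (Fin 4)) (F : MvPolynomial (Fin 4) K) :
    IsPermissibleCentre q (S.map e.toEmbedding) (rename e F) ↔ IsPermissibleCentre q S F := by
  unfold IsPermissibleCentre
  rw [Finset.map_nonempty, ordAlong_rename]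

omit [DecidableEq K] in
/-- The shade is invariant under renaming. [cite: Hauser2010, §F (definition of the shade)] -/
theorem shade_rename (s : State K) : (s.rename e).shade = s.shade := by
  show ordZero (rename e s.F) - ((s.r.mapDomain e).degree : ℕ∞) = ordZero s.F - (s.r.degree : ℕ∞)
  rw [ordZero_rename, Finsupp.degree_mapDomain]

omit [DecidableEq K] in
/-- Condition (2) is equivariant. [cite: HauserPerlega2019PRIMS, §2 (condition (2))] -/
theorem perm2_rename_iff (S : Finset (Fin 4)) (s : State K) :
    Perm2 (S.map e.toEmbedding) (s.rename e) ↔ Perm2 S s := by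
  unfold Perm2
  rw [rename_r, rename_F, degIn_map, shade_rename, ordAlong_rename]

omit [DecidableEq K] in
/-- The MODE-1h centre predicate (all ties allowed) is equivariant.
[cite: HauserPerlega2019PRIMS, §2 (permissible blowups)] -/
theorem isMode1hCentre_rename_iff (q : ℕ) (S : Finset (Fin 4)) (F : MvPolynomial (Fin 4) K) :
    IsMode1hCentre q (S.map e.toEmbedding) (rename e F) ↔ IsMode1hCentre q S F := by
  constructor
  · rintro ⟨hS, hmin⟩
    refine ⟨(isPermissibleCentre_rename_iff e q S F).mp hS, fun S' hS' => ?_⟩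
    have h := hmin (S'.map e.toEmbedding) ((isPermissibleCentre_rename_iff e q S' F).mpr hS')
    rwa [Finset.card_map, Finset.card_map] at h
  · rintro ⟨hS, hmin⟩
    refine ⟨(isPermissibleCentre_rename_iff e q S F).mpr hS, fun S'' hS'' => ?_⟩
    have hperm : IsPermissibleCentre q (S''.map e.symm.toEmbedding) F := by
      rw [← isPermissibleCentre_rename_iff e, map_symm_map]; exact hS''
    have h := hmin _ hperm
    rwa [Finset.card_map, ← Finset.card_map e.toEmbedding] at h

omit [DecidableEq K] in
/-- Equimultiplicity of the chart point is equivariant. [cite: Hauser2010, §F (equiconstant points)] -/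
theorem isEquimultiplePoint_rename_iff (q : ℕ) (S : Finset (Fin 4)) (j : Fin 4) (b : Fin 4 → K)
    (s : State K) :
    IsEquimultiplePoint q (S.map e.toEmbedding) (e j) (b ∘ e.symm) (s.rename e) ↔
      IsEquimultiplePoint q S j b s := by
  unfold IsEquimultiplePoint
  rw [pointTransform_rename]
  constructor
  · intro h d hd hdeg
    have hne : d.mapDomain e ≠ 0 := fun h0 =>
      hd (Finsupp.mapDomain_injective e.injective (by rw [h0, Finsupp.mapDomain_zero]))
    have := h (d.mapDomain e) hne (by rwa [Finsupp.degree_mapDomain])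
    rwa [coeff_rename_mapDomain e e.injective] at this
  · intro h D hD hdeg
    rw [coeff_rename_perm]
    refine h _ (fun h0 => hD ?_) (by rwa [Finsupp.degree_mapDomain])
    exact Finsupp.mapDomain_injective e.symm.injective (by rw [h0, Finsupp.mapDomain_zero])

/-- **Edges are equivariant**: an edge `s ⟶ s'` along `S` renames to an edge `e s ⟶ e s'` along `e S` (chart
`e j`, point `b ∘ e⁻¹`). [cite: HauserPerlega2019PRIMS, §2 (the blowup in the x₁-chart)] -/
theorem edge_rename {q : ℕ} {S : Finset (Fin 4)} {s s' : State K} (h : Edge q S s s') :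
    Edge q (S.map e.toEmbedding) (s.rename e) (s'.rename e) := by
  obtain ⟨j, b, hj, hbj, heq, hne, rfl⟩ := h
  refine ⟨e j, b ∘ e.symm, (Finset.mem_map' e.toEmbedding).mpr hj, ?_,
    (isEquimultiplePoint_rename_iff e q S j b s).mpr heq, ?_, (step_rename e q S j b s).symm⟩
  · show b (e.symm (e j)) = 0
    rw [Equiv.symm_apply_apply]; exact hbj
  · rw [step_rename, rename_F]
    exact fun h0 => hne (rename_injective (⇑e) e.injective (by rw [h0, map_zero]))

/-- MODE-0 steps are equivariant. [folklore] -/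
theorem step0_rename {q : ℕ} {s s' : State K} (h : Step0 q s s') : Step0 q (s.rename e) (s'.rename e) := by
  refine ⟨?_, ?_⟩
  · rw [rename_F, ← Finset.map_univ_equiv e, ordAlong_rename]; exact h.1
  · rw [← Finset.map_univ_equiv e]; exact edge_rename e h.2

/-- MODE-1h steps (the relation of record, all ties allowed) are equivariant. [folklore] -/
theorem step1h_rename {q : ℕ} {s s' : State K} (h : Step1h q s s') : Step1h q (s.rename e) (s'.rename e) := by
  obtain ⟨S, hS, hE⟩ := h
  exact ⟨S.map e.toEmbedding, (isMode1hCentre_rename_iff e q S s.F).mpr hS, edge_rename e hE⟩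

/-- MODE-2 steps are equivariant. [folklore] -/
theorem step2_rename {q : ℕ} {s s' : State K} (h : Step2 q s s') : Step2 q (s.rename e) (s'.rename e) := by
  obtain ⟨S, hS, hE⟩ := h
  exact ⟨S.map e.toEmbedding, (isPermissibleCentre_rename_iff e q S s.F).mpr hS, edge_rename e hE⟩

/-- HP-permissible steps are equivariant. [folklore] -/
theorem stepHP_rename {q : ℕ} {s s' : State K} (h : StepHP q s s') : StepHP q (s.rename e) (s'.rename e) := by
  obtain ⟨S, hS, h2, hE⟩ := h
  exact ⟨S.map e.toEmbedding, (isPermissibleCentre_rename_iff e q S s.F).mpr hS,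
    (perm2_rename_iff e S s).mpr h2, edge_rename e hE⟩

/-- The steps of an EQUIVARIANT rule are equivariant (a non-equivariant rule — e.g. a lex tie-break among
MODE-1h ties — has no such property). [folklore] -/
theorem stepRule_rename {q : ℕ} {R : CentreRule K} (hR : IsEquivariantRule R) {s s' : State K}
    (h : StepRule q R s s') : StepRule q R (s.rename e) (s'.rename e) := by
  obtain ⟨hperm, hE⟩ := h
  unfold StepRule
  rw [hR e s]
  exact ⟨(isPermissibleCentre_rename_iff e q (R s) s.F).mpr hperm, edge_rename e hE⟩

/-- `Step1h` is a relation on S₄-orbits. [folklore] -/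
theorem step1h_rename_iff {q : ℕ} {s s' : State K} : Step1h q (s.rename e) (s'.rename e) ↔ Step1h q s s' :=
  ⟨fun h => by simpa only [rename_rename_symm] using step1h_rename e.symm h, step1h_rename e⟩

/-- `Step0` is a relation on S₄-orbits. [folklore] -/
theorem step0_rename_iff {q : ℕ} {s s' : State K} : Step0 q (s.rename e) (s'.rename e) ↔ Step0 q s s' :=
  ⟨fun h => by simpa only [rename_rename_symm] using step0_rename e.symm h, step0_rename e⟩

/-- `Step2` is a relation on S₄-orbits. [folklore] -/
theorem step2_rename_iff {q : ℕ} {s s' : State K} : Step2 q (s.rename e) (s'.rename e) ↔ Step2 q s s' :=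
  ⟨fun h => by simpa only [rename_rename_symm] using step2_rename e.symm h, step2_rename e⟩

/-- `StepHP` is a relation on S₄-orbits. [folklore] -/
theorem stepHP_rename_iff {q : ℕ} {s s' : State K} : StepHP q (s.rename e) (s'.rename e) ↔ StepHP q s s' :=
  ⟨fun h => by simpa only [rename_rename_symm] using stepHP_rename e.symm h, stepHP_rename e⟩

omit [DecidableEq K] in
/-- The flag RISE:d is invariant. [cite: Hauser2010, §F (increase of the shade)] -/
theorem riseD_rename_iff (s s' : State K) : RiseD (s.rename e) (s'.rename e) ↔ RiseD s s' := by
  unfold RiseD; rw [shade_rename, shade_rename]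

omit [DecidableEq K] in
/-- The flag DROP is invariant. [folklore] -/
theorem dropD_rename_iff (s s' : State K) : DropD (s.rename e) (s'.rename e) ↔ DropD s s' := by
  unfold DropD; rw [shade_rename, shade_rename]

/-- **The S₄-image of a trap is a trap.** [folklore] -/
theorem isTrap_image {q : ℕ} {T : Set (State K)} (hT : IsTrap q T) : IsTrap q (State.rename e '' T) := by
  rintro _ ⟨s, hs, rfl⟩
  obtain ⟨hord, hall⟩ := hT s hs
  refine ⟨?_, fun S'' hS'' => ?_⟩
  · rw [rename_F, ← Finset.map_univ_equiv e, ordAlong_rename]; exact hord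
  · have hperm : IsPermissibleCentre q (S''.map e.symm.toEmbedding) s.F := by
      rw [← isPermissibleCentre_rename_iff e, map_symm_map]; exact hS''
    obtain ⟨t, ht, hedge⟩ := hall _ hperm
    refine ⟨t.rename e, ⟨t, ht, rfl⟩, ?_⟩
    have h := edge_rename e hedge
    rwa [map_symm_map] at h

end Cell

end Equivariance

end Summit.ResolutionOfSingularities.ResolutionOfSingularities.Theorems.PIDim4

end
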